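import Literature.MathematicalPhysics.QuantumLattice.SectorisedEffectiveActionBound
import Literature.MathematicalPhysics.QuantumLattice.SectorisedKernelNormExtraction
import Literature.MathematicalPhysics.QuantumLattice.GrassmannLinearSubstitution
import HarnessLib

/-!
# The substitution/analysis product `S(F̃) · (ε_x • E(F)) = diag(Σ_ω F̃_ω F_ω)` and the FACTORISATION of a pulled-back slice covariance
# through the sector fields (`((ε_x • E(F))·T)ᵀ · (S(F̃)ᵀ C S(F̃)) · ((ε_x • E(F))·T) = Tᵀ C T` on the plateau)

Topic `MathematicalPhysics/QuantumLattice`; continuation of `HubbardSectorFieldSubstitution` / `SectorisedEffectiveActionBound` (BGM 2006, §2.5 (2.48),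
§2.7 (2.66)–(2.71)).  Three exact identities behind «the external legs of a sectorised step may be kept in ANY representation of the fields that
factors through the momenta»:

* `sum_sectorLeg_ite` — sums over sector labels with spin and charge prescribed;
* **`sectorSubMatrix_mul_sectorAnalysisMatrix`** — `S(F̃) · E(F) = diag (|Λ|/(βL²) · Σ_ω F̃_ω(k) F_ω(k))` (plane-wave orthogonality on the space-time
  lattice, `sum_hubbardPlaneWave_mul_conj`); with `ε_x |Λ| = βL²`: **`sectorSubMatrix_mul_smul_sectorAnalysisMatrix`** —
  `S(F̃) · (ε_x • E(F)) = diag (Σ_ω F̃_ω(k) F_ω(k))`, which is `diag (Σ_ω F_ω)` when `F̃F = F`;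
* (the companion identity `sectorPreimage β F G = map (toLin' (ε_x • E(F))) G` — BGM (2.70) as a linear substitution — is k3c4-p1's
  `TwoVolumeDefect.sectorPreimage_eq_map_smul_sectorAnalysis` / `sectorPreimage_map_eq_map_mul`, `Theorems/KLProgrammeKLRegimeTwoVolumeSectorPreimageMap`);
* **`smul_sectorAnalysis_factorisation`** — for ANY matrix `T : Matrix (HubbardFieldIdx L M) Γ ℂ` (e.g. the grid substitution) and any momentum
  covariance `C` with the plateau condition `Σ_ω F_ω = 1` on the momenta of `supp C` (and `F̃F = F`):
  `((ε_x • E(F)) · T)ᵀ · (S(F̃)ᵀ C S(F̃)) · ((ε_x • E(F)) · T) = Tᵀ · C · T` — the covariance `Tᵀ C T` of the `T`-fields FACTORS through the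
  sectorised propagator `S(F̃)ᵀ C S(F̃)` of BGM (2.66)–(2.67) along the substitution `(ε_x • E(F)) · T`, whose image of a `T`-polynomial `W` is the
  sector preimage of `map (toLin' T) W`.  (With the spectator read-out of `GrassmannSpectatorReadout` this is the door through which plain external
  legs of a sectorised step are read.)

Everything is proved; no definition, no named fact.

## Sources
G. Benfatto, A. Giuliani, V. Mastropietro, Ann. Henri Poincaré 7 (2006) 809–898, §2.5 (2.48), §2.7 (2.66)–(2.71) [`BenfattoGiulianiMastropietro2006`];
M. Salmhofer, *Renormalization: An Introduction* (Springer 1999), App. B.2 (B.23)–(B.25), App. B.5.5 [`Salmhofer1999`].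
-/

noncomputable section

namespace Literature.MathematicalPhysics.QuantumLattice

open GrassmannAlgebra Finset Literature.Probability.LatticeModels

/-! ### Sums over sector labels with spin and charge prescribed -/

/-- `Σ_{((a,σ'),c')} [σ = σ' ∧ c = c'] g = Σ_a g((a,σ),c)` (labels of the shape `(A × Fin 2) × Fin 2`). [cite: BenfattoGiulianiMastropietro2006, §2.7 (2.70)] -/
theorem sum_sectorLeg_ite {B : Type*} [AddCommMonoid B] {A : Type*} [Fintype A] (σ c : Fin 2) (g : (A × Fin 2) × Fin 2 → B) :
    ∑ ℓ : (A × Fin 2) × Fin 2, (if σ = ℓ.1.2 ∧ c = ℓ.2 then g ℓ else 0) = ∑ a : A, g ((a, σ), c) := by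
  rw [Fintype.sum_prod_type, Fintype.sum_prod_type]
  refine sum_congr rfl fun a _ => ?_
  rw [Finset.sum_eq_single_of_mem σ (mem_univ _) fun σ' _ hσ' => sum_eq_zero fun c' _ => if_neg fun h => hσ' h.1.symm,
    Finset.sum_eq_single_of_mem c (mem_univ _) fun c' _ hc' => if_neg fun h => hc' h.2.symm, if_pos ⟨rfl, rfl⟩]

/-! ### The substitution/analysis product -/

section Matrices

variable {L M : ℕ} [NeZero L] [NeZero M] {N : ℕ}

omit [NeZero M] in
/-- **`S(F̃) · E(F) = diag (|Λ|/(βL²) · Σ_ω F̃_ω(k) F_ω(k))`** (`β ≠ 0`): substituting the sector fields and analysing again is diagonal in the momentum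
fields, by the orthogonality of the plane waves on the space-time lattice. [cite: BenfattoGiulianiMastropietro2006, §2.5 (2.48)] -/
theorem sectorSubMatrix_mul_sectorAnalysisMatrix {β : ℝ} (hβ : β ≠ 0) (F Ft : Fin N → FreqMomentum L M → ℂ) :
    sectorSubMatrix L M β Ft * sectorAnalysisMatrix L M β F =
      Matrix.diagonal (fun K : HubbardFieldIdx L M =>
        (((1 / (β * (L : ℝ) ^ 2) : ℝ) : ℂ) * (Fintype.card (SpaceTimeIdx L M) : ℂ)) * ∑ ω, Ft ω K.1.1 * F ω K.1.1) := by
  ext K K'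
  rw [Matrix.mul_apply, Matrix.diagonal_apply, Fintype.sum_prod_type]
  -- unfold the substitution factor: the sector label carries the spin and charge of `K`
  have hS : ∀ (x : SpaceTimeIdx L M) (ℓ : SectorLeg N),
      sectorSubMatrix L M β Ft K (x, ℓ) * sectorAnalysisMatrix L M β F (x, ℓ) K' =
        if K.1.2 = ℓ.1.2 ∧ K.2 = ℓ.2 then
          ((1 / (β * (L : ℝ) ^ 2) : ℝ) : ℂ) * (Ft ℓ.1.1 K.1.1 * (starRingEnd ℂ) (hubbardPlaneWave L M β ℓ.2 K.1.1 x)) * sectorAnalysisMatrix L M β F (x, ℓ) K'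
        else 0 := by
    intro x ℓ
    rw [sectorSubMatrix_apply]
    split_ifs <;> simp
  simp_rw [hS, sum_sectorLeg_ite]
  -- unfold the analysis factor: it forces the spin and charge of `K′` to be those of `K`
  simp only [sectorAnalysisMatrix_apply]
  by_cases h2 : K'.1.2 = K.1.2 ∧ K'.2 = K.2
  · simp_rw [if_pos h2]
    rw [sum_comm]
    have hx : ∀ ω : Fin N, ∑ x : SpaceTimeIdx L M,
        ((1 / (β * (L : ℝ) ^ 2) : ℝ) : ℂ) * (Ft ω K.1.1 * (starRingEnd ℂ) (hubbardPlaneWave L M β K.2 K.1.1 x)) *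
          (F ω K'.1.1 * hubbardPlaneWave L M β K.2 K'.1.1 x) =
        ((1 / (β * (L : ℝ) ^ 2) : ℝ) : ℂ) * (Ft ω K.1.1 * F ω K'.1.1) * (if K'.1.1 = K.1.1 then (Fintype.card (SpaceTimeIdx L M) : ℂ) else 0) := by
      intro ω
      rw [← sum_hubbardPlaneWave_mul_conj hβ K.2 K.1.1 K'.1.1, mul_sum]
      exact sum_congr rfl fun x _ => by ring
    simp_rw [hx]
    by_cases hk : K'.1.1 = K.1.1
    · have hKK : K = K' := Prod.ext (Prod.ext hk.symm h2.1.symm) h2.2.symm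
      simp_rw [if_pos hk]
      rw [if_pos hKK, mul_sum, ← hk]
      exact sum_congr rfl fun ω _ => by ring
    · simp_rw [if_neg hk, mul_zero]
      rw [sum_const_zero, if_neg (fun h => hk (by rw [h]))]
  · simp_rw [if_neg h2, mul_zero, sum_const_zero]
    rw [if_neg (fun h => h2 (by rw [h]; exact ⟨rfl, rfl⟩))]

/-- **`S(F̃) · (ε_x • E(F)) = diag (Σ_ω F̃_ω(k) F_ω(k))`** (`β ≠ 0`; `ε_x |Λ| = βL²`). [cite: BenfattoGiulianiMastropietro2006, §2.7 (2.70)] -/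
theorem sectorSubMatrix_mul_smul_sectorAnalysisMatrix {β : ℝ} (hβ : β ≠ 0) (F Ft : Fin N → FreqMomentum L M → ℂ) :
    sectorSubMatrix L M β Ft * (((imagTimeWeight β M : ℝ) : ℂ) • sectorAnalysisMatrix L M β F) =
      Matrix.diagonal (fun K : HubbardFieldIdx L M => ∑ ω, Ft ω K.1.1 * F ω K.1.1) := by
  rw [Matrix.mul_smul, sectorSubMatrix_mul_sectorAnalysisMatrix hβ F Ft, Matrix.smul_eq_diagonal_mul, Matrix.diagonal_mul_diagonal]
  congr 1
  funext K
  have hcard : ((imagTimeWeight β M : ℝ) : ℂ) * (((1 / (β * (L : ℝ) ^ 2) : ℝ) : ℂ) * (Fintype.card (SpaceTimeIdx L M) : ℂ)) = 1 := by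
    have hβ' : (β : ℂ) ≠ 0 := by exact_mod_cast hβ
    have hL' : ((L : ℝ) : ℂ) ≠ 0 := by exact_mod_cast (NeZero.ne L)
    have hL'' : (L : ℂ) ≠ 0 := by exact_mod_cast (NeZero.ne L)
    have h' : ((imagTimeWeight β M : ℝ) : ℂ) * (Fintype.card (SpaceTimeIdx L M) : ℂ) = ((β * (L : ℝ) ^ 2 : ℝ) : ℂ) := by
      exact_mod_cast imagTimeWeight_mul_card β L M
    calc ((imagTimeWeight β M : ℝ) : ℂ) * (((1 / (β * (L : ℝ) ^ 2) : ℝ) : ℂ) * (Fintype.card (SpaceTimeIdx L M) : ℂ))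
        = ((1 / (β * (L : ℝ) ^ 2) : ℝ) : ℂ) * (((imagTimeWeight β M : ℝ) : ℂ) * (Fintype.card (SpaceTimeIdx L M) : ℂ)) := by ring
      _ = ((1 / (β * (L : ℝ) ^ 2) : ℝ) : ℂ) * ((β * (L : ℝ) ^ 2 : ℝ) : ℂ) := by rw [h']
      _ = 1 := by
          push_cast
          field_simp
  rw [← mul_assoc, hcard, one_mul]

/-- With a fat family (`F̃F = F`): `S(F̃) · (ε_x • E(F)) = diag (Σ_ω F_ω(k))` — the plateau function on the diagonal.
[cite: BenfattoGiulianiMastropietro2006, §2.7 (2.70)] -/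
theorem sectorSubMatrix_mul_smul_sectorAnalysisMatrix_of_fat {β : ℝ} (hβ : β ≠ 0) (F Ft : Fin N → FreqMomentum L M → ℂ)
    (hFF : ∀ ω k, Ft ω k * F ω k = F ω k) :
    sectorSubMatrix L M β Ft * (((imagTimeWeight β M : ℝ) : ℂ) • sectorAnalysisMatrix L M β F) =
      Matrix.diagonal (fun K : HubbardFieldIdx L M => ∑ ω, F ω K.1.1) := by
  rw [sectorSubMatrix_mul_smul_sectorAnalysisMatrix hβ F Ft]
  congr 1
  funext K
  exact sum_congr rfl fun ω _ => hFF ω K.1.1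

end Matrices

/-! ### The factorisation of a pulled-back covariance through the sector fields -/

section Factorisation

variable {L M : ℕ} [NeZero L] [NeZero M] {N : ℕ}

/-- **THE FACTORISATION** (`β ≠ 0`, `F̃F = F`, plateau: `Σ_ω F_ω = 1` on the momenta of `supp C`): for every matrix `T` of momentum rows,
`((ε_x • E(F)) · T)ᵀ · (S(F̃)ᵀ · C · S(F̃)) · ((ε_x • E(F)) · T) = Tᵀ · C · T` — the covariance of the `T`-fields pulled back from `C` factors through
the sectorised propagator of BGM (2.66)–(2.67) along the substitution `(ε_x • E(F)) · T`. [cite: BenfattoGiulianiMastropietro2006, §2.7 (2.66)-(2.70)] -/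
theorem smul_sectorAnalysis_factorisation {Γ : Type*} [Fintype Γ] {β : ℝ} (hβ : β ≠ 0) (F Ft : Fin N → FreqMomentum L M → ℂ)
    (hFF : ∀ ω k, Ft ω k * F ω k = F ω k) (C : Matrix (HubbardFieldIdx L M) (HubbardFieldIdx L M) ℂ)
    (hCpl : ∀ X Y, C X Y ≠ 0 → ∑ ω, F ω X.1.1 = 1 ∧ ∑ ω, F ω Y.1.1 = 1) (T : Matrix (HubbardFieldIdx L M) Γ ℂ) :
    ((((imagTimeWeight β M : ℝ) : ℂ)) • sectorAnalysisMatrix L M β F * T).transpose *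
        ((sectorSubMatrix L M β Ft).transpose * C * sectorSubMatrix L M β Ft) *
        ((((imagTimeWeight β M : ℝ) : ℂ)) • sectorAnalysisMatrix L M β F * T) = T.transpose * C * T := by
  set E := (((imagTimeWeight β M : ℝ) : ℂ)) • sectorAnalysisMatrix L M β F with hE
  set S := sectorSubMatrix L M β Ft with hS
  set R : HubbardFieldIdx L M → ℂ := fun K => ∑ ω, F ω K.1.1 with hR
  have hSE : S * E = Matrix.diagonal R := by rw [hS, hE, hR]; exact sectorSubMatrix_mul_smul_sectorAnalysisMatrix_of_fat hβ F Ft hFF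
  have hcov : (Matrix.diagonal R).transpose * C * Matrix.diagonal R = C := by
    rw [diagonal_transpose_mul_mul_diagonal]
    ext X Y
    rw [Matrix.of_apply]
    by_cases h0 : C X Y = 0
    · rw [h0, mul_zero]
    · obtain ⟨h1, h2⟩ := hCpl X Y h0
      rw [show R X = 1 from h1, show R Y = 1 from h2, one_mul, one_mul]
  calc (E * T).transpose * (S.transpose * C * S) * (E * T)
      = T.transpose * ((S * E).transpose * C * (S * E)) * T := by
        rw [Matrix.transpose_mul, Matrix.transpose_mul]
        simp only [Matrix.mul_assoc]
    _ = T.transpose * C * T := by rw [hSE, hcov]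

end Factorisation

end Literature.MathematicalPhysics.QuantumLattice

end
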